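import Summits.CriticalPhenomena.PercolationContinuityZ3.Theorems.Transplant.PlanarSkeletonBoxProd
import Summits.CriticalPhenomena.PercolationContinuityZ3.Theorems.Transplant.BoxProdSlabQuotient
import Summits.CriticalPhenomena.PercolationContinuityZ3.Theorems.Transplant.HeisenbergZCylSubcritical
import HarnessLib

/-!
# Benjamini–Schramm's Conjecture 4 for EVERY `X □ (H₃(ℤ) × ℤ)` from the lane's general node alone
# (`X` infinite or finite, connected, locally finite, quasi-transitive; no residue)

builds on p205010 (kernel theorem, internal audit signed; external expert review pending) — nothing in this file uses p205010.
Lane `prim-bschramm`, seat `prim-bschramm-p4` (gen 3; class map, memo `P4-GENERAL.md` §11), helper file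
(`--supports stmt-CriticalPhenomena-4575`).  Conditional on the GENERAL planar-skeleton node (`SamePWitnessOfSkeleton`, or its drop
form `SamePDropOfSkeleton`) — NOT on the product node `ThetaDropBoxProdZ2` of design (D) (two-nodes guard, VERDICTS V63); the node is
not claimed.

For every connected, locally finite, quasi-transitive `X` the Cartesian product `X □ Cay(H₃(ℤ) × ℤ)` satisfies
`θ_v(p_c) = 0` at every vertex, GIVEN THE NODE:
* `X` of exponential growth: Hutchcroft's theorem on the product (`theta_boxProd_criticalProb_eq_zero_of_expGrowth`, no node needed);
* `X` of subexponential growth: the product is amenable (`isGraphAmenable_boxProd_of_polyGrowth` with `|B_{H₃×ℤ}(n)| ≤ (2n+1)⁵`), so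
  the infinite cluster is unique (Burton–Keane); the product skeleton `boxProdHZSkeleton = hzSkeleton.boxProdLeft X` (φ = `(a,b)` of
  the second factor) has cylinders `X × hzCyl ℓ` (`boxProdHZSkeleton_cyl`), which are strictly subcritical at `p_c(X □ (H₃×ℤ))` by the
  slab–quotient criterion on the product (`BoxProdSlabQuotient.lean`) fed with the `a`-slab data of `HeisenbergZSlabA.lean`
  (`boxProdHZ_cylSubcritical`) — so `continuity_of_skeleton_amenable` / `continuity_of_skeleton_drop_amenable` apply.
Results: `bsConj4_boxProdHeisenbergZ_of_skeletonNode`, `bsConj4_boxProdHeisenbergZ_of_dropNode`.  Examples covered: `H₃(ℤ) × H₃(ℤ) × ℤ`,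
`ℤ^k × H₃(ℤ) × ℤ`, `G × H₃(ℤ) × ℤ` for `G` of intermediate growth — all 'node only'.
[cite: BenjaminiSchramm1996, Conj. 4 and §2] [cite: MartineauSevero2019, Cor. 2.2] [cite: Hutchcroft2016, Thm. 1] [cite: LyonsPeres2016, §6.1, Thm. 7.6]
[cite: KozmaNitzan2024, §1 p. 2 (approach 1)]
-/

noncomputable section

namespace Summit.CriticalPhenomena.PercolationContinuityZ3.Theorems.Transplant

open MeasureTheory Literature.Probability.Percolation Literature.Probability.LatticeModels
open Literature.Barriers.CriticalPhenomena (IsQuasiTransitive IsGraphAmenable HasExponentialGrowth countable_of_connected_of_locallyFinite)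
open HeisenbergZ

variable {W : Type}

/-! ## §1 The product skeleton and its cylinders -/

/-- **The planar skeleton of `X □ (H₃(ℤ) × ℤ)`**: `φ = (a,b)` of the second factor. [cite: KozmaNitzan2024, §4 p. 15] -/
def boxProdHZSkeleton (X : SimpleGraph W) (hq : IsQuasiTransitive X) : PlanarSkeleton (X □ heisenbergZGraph) :=
  hzSkeleton.boxProdLeft X hq

/-- Its base vertices are the `(v, 1)`, `v` in the quasi-transitivity witness of `X`. [folklore] -/
theorem snd_eq_zero_of_mem_boxProdHZSkeleton_types (X : SimpleGraph W) (hq : IsQuasiTransitive X) {t : W × HZ}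
    (ht : t ∈ (boxProdHZSkeleton X hq).types) : t.2 = 0 := by
  have h := ((PlanarSkeleton.mem_types_boxProdLeft X hq hzSkeleton t).1 ht).2
  simpa [hzSkeleton] using h

/-- **Its cylinders at `(x, 1)` are `X × hzCyl ℓ`** (thick: all of `X` times the central coset direction `⟨C,T⟩`). [folklore] -/
theorem boxProdHZSkeleton_cyl (X : SimpleGraph W) (hq : IsQuasiTransitive X) (x : W) (ℓ : ℕ) :
    (boxProdHZSkeleton X hq).cyl (x, (0 : HZ)) ℓ = (Set.univ : Set W) ×ˢ hzCyl ℓ := by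
  rw [boxProdHZSkeleton, PlanarSkeleton.cyl_boxProdLeft, ← hzSkeleton_cyl ℓ]

/-! ## §2 Input Φ2 of the product skeleton at `p_c`: the slab–quotient criterion on the product -/

/-- The family of slab shifts of the `a`-slab (left translations by `{a = 0}`). [folklore] -/
def hzSlabShifts (L : ℕ) : Set (hzSlabAGraph L ≃g hzSlabAGraph L) :=
  Set.range fun bct : ℤ × ℤ × ℤ => hzSlabShift L bct.1 bct.2.1 bct.2.2

/-- **The cylinders `X × hzCyl ℓ` of `X □ (H₃(ℤ) × ℤ)` do not percolate at `p_c(X □ (H₃(ℤ) × ℤ))`** (`X` connected, locally finite,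
quasi-transitive): the slab–quotient criterion on the product with the `a`-slab `{|a| ≤ ℓ+1}`, `Γ = ⟨B^{2ℓ+2}⟩`.
[cite: MartineauSevero2019, Cor. 2.2] -/
theorem boxProdHZ_cylSubcritical (X : SimpleGraph W) [X.LocallyFinite] (hc : X.Connected) (hq : IsQuasiTransitive X) (x : W) (ℓ : ℕ) :
    theta ((X □ heisenbergZGraph).induce ((Set.univ : Set W) ×ˢ hzCyl ℓ))
      ⟨(x, (0 : HZ)), Set.mk_mem_prod (Set.mem_univ x) (zero_mem_hzCyl ℓ)⟩ (criticalProbIOf (X □ heisenbergZGraph) (x, (0 : HZ))) = 0 := by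
  classical
  have hL : 1 ≤ ℓ + 1 := Nat.le_add_left 1 ℓ
  have hN : 2 * ℓ + 1 < 2 * ℓ + 2 := Nat.lt_succ_self _
  have hN' : 2 * ℓ < 2 * ℓ + 2 := by omega
  have hN0 : 2 * ℓ + 2 ≠ 0 := Nat.succ_ne_zero _
  refine theta_boxProd_induce_cyl_criticalProb_eq_zero X heisenbergZGraph (Γ := BShift (2 * ℓ + 2)) (S := hzSlabA (ℓ + 1))
    hc hq (hzCyl_subset_hzSlabA (Nat.le_succ ℓ)) (bShift_isActionByAut (2 * ℓ + 2) (ℓ + 1)) (bShift_free hN0)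
    (hzSlabAGraph_connected hL) (hzSlabAGraph_quasiTransitive (ℓ + 1)) ((hzSlabAReps (ℓ + 1)).subtype (· ∈ hzSlabA (ℓ + 1)))
    (hzSlabShifts (ℓ + 1)) ?_ ?_ (hzSlabAOrigin (ℓ + 1)) (criticalProb_hzSlabA_lt_one (ℓ + 1))
    (fun _ _ hy hgy => eq_one_of_smul_mem_hzCyl hN' hy hgy) (fun _ _ _ hy hz h => eq_one_of_adj_smul_hzCyl hN hy hz h) x
    (zero_mem_hzCyl ℓ)
  · rintro τ ⟨⟨b, c, t⟩, rfl⟩ g y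
    exact hzSlabShift_smul b c t g y
  · intro y
    exact ⟨hzSlabShift (ℓ + 1) (-(y : HZ) 1) (-(y : HZ) 2) (-(y : HZ) 3), ⟨(-(y : HZ) 1, -(y : HZ) 2, -(y : HZ) 3), rfl⟩,
      Finset.mem_subtype.2 (hzSlabShift_mem_reps (ℓ + 1) y)⟩

/-- … packaged as input Φ2 of the product skeleton at `p_c` (at any base vertex). [cite: MartineauSevero2019, Cor. 2.2] -/
theorem boxProdHZSkeleton_cylSubcritical (X : SimpleGraph W) [X.LocallyFinite] (hc : X.Connected) (hq : IsQuasiTransitive X)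
    (v : W × HZ) : (boxProdHZSkeleton X hq).CylSubcritical (criticalProbIOf (X □ heisenbergZGraph) v) := by
  haveI : Countable W := countable_of_connected_of_locallyFinite X hc v.1
  have hconn : (X □ heisenbergZGraph).Connected := hc.boxProd heisenbergZGraph_connected
  intro t' ht' ℓ
  obtain ⟨x', y'⟩ := t'
  have hy' : y' = 0 := snd_eq_zero_of_mem_boxProdHZSkeleton_types X hq ht'
  subst hy'
  rw [theta_induce_congr (X □ heisenbergZGraph) (boxProdHZSkeleton_cyl X hq x' ℓ)]
  have hpc : criticalProbIOf (X □ heisenbergZGraph) v = criticalProbIOf (X □ heisenbergZGraph) (x', (0 : HZ)) :=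
    Subtype.ext (criticalProb_eq_of_reachable _ (hconn.preconnected _ _))
  rw [hpc]
  exact boxProdHZ_cylSubcritical X hc hq x' ℓ

/-! ## §3 Conjecture 4 for `X □ (H₃(ℤ) × ℤ)` from the node -/

/-- **`θ_{X □ (H₃(ℤ)×ℤ)}(v, p_c) = 0` at every vertex, from the general WITNESS node** (`X` connected, locally finite, quasi-transitive):
growth dichotomy — Hutchcroft for exponential growth; amenable + Burton–Keane + product skeleton + Φ2 by §2 otherwise.  Conditional on
`SamePWitnessOfSkeleton` only. [cite: BenjaminiSchramm1996, Conj. 4] [cite: Hutchcroft2016, Thm. 1] [cite: KozmaNitzan2024, §1 p. 2 (approach 1)] -/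
theorem bsConj4_boxProdHeisenbergZ_of_skeletonNode (hW : SamePWitnessOfSkeleton) (X : SimpleGraph W) [X.LocallyFinite]
    (hc : X.Connected) (hq : IsQuasiTransitive X) (v : W × HZ) :
    theta (X □ heisenbergZGraph) v (criticalProbIOf (X □ heisenbergZGraph) v) = 0 := by
  classical
  by_cases hg : HasExponentialGrowth X
  · exact theta_boxProd_criticalProb_eq_zero_of_expGrowth X heisenbergZGraph hc heisenbergZGraph_connected hq
      heisenbergZGraph_quasiTransitive hg v
  · have hconn : (X □ heisenbergZGraph).Connected := hc.boxProd heisenbergZGraph_connected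
    haveI : Countable W := countable_of_connected_of_locallyFinite X hc v.1
    have ha : IsGraphAmenable (X □ heisenbergZGraph) :=
      isGraphAmenable_boxProd_of_polyGrowth X heisenbergZGraph hq heisenbergZGraph_quasiTransitive 5 ballVolume_heisenbergZ_le hg
    obtain ⟨t, ht, -⟩ := (boxProdHZSkeleton X hq).frame v
    have h0 : theta (X □ heisenbergZGraph) t (criticalProbIOf (X □ heisenbergZGraph) t) = 0 :=
      continuity_of_skeleton_amenable hW (X □ heisenbergZGraph) (boxProdHZSkeleton X hq) hconn
        (isQuasiTransitive_boxProd hq heisenbergZGraph_quasiTransitive) ha t ht (boxProdHZSkeleton_cylSubcritical X hc hq t)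
    exact theta_criticalProbIOf_eq_zero_of_reachable (X □ heisenbergZGraph) (hconn.preconnected _ _) h0

/-- **… and from the general DROP node** (design (D)).  Conditional on `SamePDropOfSkeleton` only.
[cite: BenjaminiSchramm1996, Conj. 4] [cite: KozmaNitzan2024, §1 p. 2 (approach 1)] -/
theorem bsConj4_boxProdHeisenbergZ_of_dropNode (hD : SamePDropOfSkeleton) (X : SimpleGraph W) [X.LocallyFinite]
    (hc : X.Connected) (hq : IsQuasiTransitive X) (v : W × HZ) :
    theta (X □ heisenbergZGraph) v (criticalProbIOf (X □ heisenbergZGraph) v) = 0 := by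
  classical
  by_cases hg : HasExponentialGrowth X
  · exact theta_boxProd_criticalProb_eq_zero_of_expGrowth X heisenbergZGraph hc heisenbergZGraph_connected hq
      heisenbergZGraph_quasiTransitive hg v
  · have hconn : (X □ heisenbergZGraph).Connected := hc.boxProd heisenbergZGraph_connected
    haveI : Countable W := countable_of_connected_of_locallyFinite X hc v.1
    have ha : IsGraphAmenable (X □ heisenbergZGraph) :=
      isGraphAmenable_boxProd_of_polyGrowth X heisenbergZGraph hq heisenbergZGraph_quasiTransitive 5 ballVolume_heisenbergZ_le hg
    obtain ⟨t, ht, -⟩ := (boxProdHZSkeleton X hq).frame v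
    have h0 : theta (X □ heisenbergZGraph) t (criticalProbIOf (X □ heisenbergZGraph) t) = 0 :=
      continuity_of_skeleton_drop_amenable hD (X □ heisenbergZGraph) (boxProdHZSkeleton X hq) hconn
        (isQuasiTransitive_boxProd hq heisenbergZGraph_quasiTransitive) ha t ht (boxProdHZSkeleton_cylSubcritical X hc hq t)
    exact theta_criticalProbIOf_eq_zero_of_reachable (X □ heisenbergZGraph) (hconn.preconnected _ _) h0

/-- **All hypotheses of Benjamini–Schramm's Conjecture 4 hold for `X □ (H₃(ℤ) × ℤ)`** (connected, quasi-transitive, `p_c < 1`), so the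
conjecture itself also gives the conclusion — recorded to make the class-map entry checkable against `BenjaminiSchramm1996_conj4`.
[cite: BenjaminiSchramm1996, Conj. 4 and §2] -/
theorem boxProdHeisenbergZ_conj4_hypotheses (X : SimpleGraph W) [X.LocallyFinite] (hc : X.Connected) (hq : IsQuasiTransitive X) (x : W) :
    (X □ heisenbergZGraph).Connected ∧ IsQuasiTransitive (X □ heisenbergZGraph) ∧
      criticalProb (X □ heisenbergZGraph) (x, (0 : HZ)) < 1 := by
  haveI : Countable W := countable_of_connected_of_locallyFinite X hc x
  exact ⟨hc.boxProd heisenbergZGraph_connected, isQuasiTransitive_boxProd hq heisenbergZGraph_quasiTransitive,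
    (criticalProb_boxProd_le_right X heisenbergZGraph x 0).trans_lt criticalProb_heisenbergZ_lt_one⟩

end Summit.CriticalPhenomena.PercolationContinuityZ3.Theorems.Transplant

end
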